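import Mathlib
import HarnessLib
import HarnessLib.Audit
import Literature.Analysis.FunctionSpaces.BesselJZeroSqrtLaplace
import Literature.Analysis.TotalPositivity.LaguerreLaplaceRuleOfSigns
import Summits.ValiantsHypothesis.ValiantsHypothesis.Theorems.LacunarySymmetroidMatrixDescartesToyALawMain

/-!
# ValiantsHypothesis / LacunarySymmetroid — crux `MatrixDescartes` (stmt-ValiantsHypothesis-18050, V1), LINE (A) «product_plus_one»:
# binomial-limit TOY THEOREM, module 8 — bridge to the tree's Laguerre–Laplace rule of signs; analytic-multiplicity form

Two currencies for «sign changes» exist in the tree: `ToyALaw.SignChangesLE φ S R` (modules 0–7: no alternating chain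
`x 0 < ⋯ < x (R+1)`, `x : ℕ → ℝ`) and `Literature.Analysis.TotalPositivity.LaguerreRuleOfSigns.SignReversalsLE φ S R`
(`Literature/Analysis/TotalPositivity/LaguerreLaplaceRuleOfSigns.lean`, Pólya–Szegő V §2: every increasing finite sequence has
a value sequence with `≤ R` changes of sign).  `signChangesLE_iff_signReversalsLE` proves they are EQUIVALENT (via that file's
chain characterisation `signReversalsLE_iff`).  Consequences: Pólya–Szegő V.75 of module 2 in the Literature currency
(`signReversalsLE_expPoly`), and — feeding the tree's PROVED V.80 `polyaSzego_V80_laplace_zeros_le_signReversals_holds` with the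
toy density of module 6 — the TOY THEOREM IN ANALYTIC MULTIPLICITY: for `r, λ_f, t_f > 0` the real-analytic function `A_toy`
itself has at most `2r − 1` zeros on `(0, ∞)` counted with multiplicity through iterated derivatives
(`ZerosWithMultiplicityLE (toyA t lam τ) (Ioi 0) (2r − 1)`, `toyA_zerosWithMultiplicityLE`), independently of the numerator
convention of `toyALaw`.

HONEST FRAMING: free-standing kernel helpers about the `η → 0` TOY of LINE (A)'s A-function; no LINE (A) stub touched
(A40 unchanged, sorries 4 → 4); `MatrixDescartes` OPEN; `VP ≠ VNP` is NOT proved and nothing here bears on it.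
-/

set_option linter.dupNamespace false

namespace Summit.ValiantsHypothesis.ValiantsHypothesis.Theorems.LacunarySymmetroidMatrixDescartes

namespace ToyALaw

open Polynomial Finset MeasureTheory Filter
open Literature.Analysis.FunctionSpaces (integrableOn_pow_mul_exp_neg_mul_Ioi)
open Literature.Analysis.TotalPositivity

variable {φ : ℝ → ℝ} {S : Set ℝ} {R : ℕ}

/-! ## The two sign-change currencies agree -/

/-- `SignChangesLE` (ℕ-indexed alternating chains) implies `SignReversalsLE` (Pólya–Szegő V §2, list form). -/
theorem signReversalsLE_of_signChangesLE (h : SignChangesLE φ S R) :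
    LaguerreRuleOfSigns.SignReversalsLE φ S R := by
  rw [LaguerreRuleOfSigns.signReversalsLE_iff]
  rintro l ⟨hpw, hch, hmem, -⟩
  by_contra hlen
  push Not at hlen
  obtain ⟨i, hi, h0⟩ := h (fun i => l.getD i 0)
    (fun i hi => by
      rw [List.getD_eq_getElem _ _ (by omega)]
      exact hmem _ (List.getElem_mem _))
    (fun i hi => by
      rw [List.getD_eq_getElem _ _ (by omega), List.getD_eq_getElem _ _ (by omega)]
      exact (List.pairwise_iff_getElem.1 hpw) i (i + 1) (by omega) (by omega) (by omega))
  have hlt := (List.isChain_iff_getElem.1 hch) i (by omega)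
  rw [List.getD_eq_getElem _ _ (by omega), List.getD_eq_getElem _ _ (by omega)] at h0
  exact absurd hlt (not_lt.2 h0)

/-- `SignReversalsLE` implies `SignChangesLE`. -/
theorem signChangesLE_of_signReversalsLE (h : LaguerreRuleOfSigns.SignReversalsLE φ S R) :
    SignChangesLE φ S R := by
  intro x hxS hx
  by_contra hcon
  push Not at hcon
  have hmono : ∀ i j, i < j → j ≤ R + 1 → x i < x j := by
    intro i j hij hj
    obtain ⟨d, rfl⟩ : ∃ d, j = i + d + 1 := ⟨j - i - 1, by omega⟩
    induction d with
    | zero => simpa using hx i (by omega)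
    | succ d ih =>
      have h1 := ih (by omega) (by omega)
      have h2 := hx (i + d + 1) (by omega)
      calc x i < x (i + d + 1) := h1
        _ < x (i + d + 1 + 1) := h2
        _ = x (i + (d + 1) + 1) := by ring_nf
  have hne : ∀ i ≤ R + 1, φ (x i) ≠ 0 := by
    intro i hi h0
    rcases Nat.eq_zero_or_pos i with rfl | hpos
    · have := hcon 0 (Nat.zero_le _); rw [h0, zero_mul] at this; exact lt_irrefl _ this
    · have := hcon (i - 1) (by omega)
      rw [show i - 1 + 1 = i by omega, h0, mul_zero] at this
      exact lt_irrefl _ this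
  set l : List ℝ := (List.range (R + 2)).map x with hl
  have hlen : l.length = R + 2 := by simp [hl]
  have hget : ∀ (i : ℕ) (hi : i < l.length), l[i] = x i := by
    intro i hi
    simp [hl]
  have hmeml : ∀ y ∈ l, ∃ i, i < R + 2 ∧ x i = y := by
    intro y hy
    simpa [hl, List.mem_map, List.mem_range] using hy
  have halt : LaguerreRuleOfSigns.IsAltChain φ S l := by
    refine ⟨?_, ?_, ?_, ?_⟩
    · rw [List.pairwise_iff_getElem]
      intro i j hi hj hij
      rw [hget, hget]
      exact hmono i j hij (by rw [hlen] at hj; omega)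
    · rw [List.isChain_iff_getElem]
      intro i hi
      rw [hget, hget]
      exact hcon i (by rw [hlen] at hi; omega)
    · intro y hy
      obtain ⟨i, hi, rfl⟩ := hmeml y hy
      exact hxS i (by omega)
    · intro y hy
      obtain ⟨i, hi, rfl⟩ := hmeml y hy
      exact hne i (by omega)
  have := (LaguerreRuleOfSigns.signReversalsLE_iff.1 h) l halt
  omega

/-- **The two currencies agree**: `SignChangesLE φ S R ↔ SignReversalsLE φ S R`. -/
theorem signChangesLE_iff_signReversalsLE :
    SignChangesLE φ S R ↔ LaguerreRuleOfSigns.SignReversalsLE φ S R :=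
  ⟨signReversalsLE_of_signChangesLE, signChangesLE_of_signReversalsLE⟩

/-- **Pólya–Szegő II V.75 in the Literature currency**: a real exponential polynomial `Σ_{s∈S} e^{sθ}P_s(θ)` with some
`P_s ≠ 0` has at most `Σ_s (deg P_s + 1) − 1` reversals of sign on `ℝ`. -/
theorem signReversalsLE_expPoly (T : Finset ℝ) (P : ℝ → ℝ[X]) (h : ∃ s ∈ T, P s ≠ 0) :
    LaguerreRuleOfSigns.SignReversalsLE (expPoly T P) Set.univ (∑ s ∈ T, ((P s).natDegree + 1) - 1) :=
  signReversalsLE_of_signChangesLE (signChangesLE_expPoly T P h)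

/-! ## The toy theorem in analytic multiplicity -/

variable {r : ℕ} (t lam : Fin r → ℝ) (τ : ℝ)

/-- For `λ_f > 0` the toy density is positive just right of `0`: on `(0, θ₁)`, `θ₁ = 1/((|1+τ|+1)(Σ t_f + 1))`. -/
theorem toyDensity_pos (ht : ∀ f, 0 < t f) (hlam : ∀ f, 0 < lam f) (hr : 0 < r) {θ : ℝ} (hθ : 0 < θ)
    (hθ1 : θ < 1 / ((|1 + τ| + 1) * (∑ f, t f + 1))) :
    0 < ∑ f, (lam f * t f ^ 2 * (θ ^ 1 * Real.exp (-(t f * θ))) +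
        -((1 + τ) * lam f * t f ^ 3 / 2) * (θ ^ 2 * Real.exp (-(t f * θ)))) := by
  haveI : Nonempty (Fin r) := ⟨⟨0, hr⟩⟩
  refine sum_pos (fun f _ => ?_) univ_nonempty
  have hT : t f ≤ ∑ f, t f := single_le_sum (f := t) (fun f _ => (ht f).le) (mem_univ f)
  have hpos : 0 < (|1 + τ| + 1) * (∑ f, t f + 1) := by
    have := sum_nonneg (s := Finset.univ) fun f (_ : f ∈ Finset.univ) => (ht f).le
    positivity
  have hTnn : 0 ≤ ∑ f, t f := sum_nonneg (s := Finset.univ) fun f (_ : f ∈ Finset.univ) => (ht f).le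
  have h1 : (1 + τ) * t f * θ < 1 := by
    have hθ2 : θ * ((|1 + τ| + 1) * (∑ f, t f + 1)) < 1 := by
      rwa [lt_div_iff₀ hpos] at hθ1
    have h3a : (1 + τ) * t f * θ ≤ |1 + τ| * t f * θ :=
      mul_le_mul_of_nonneg_right (mul_le_mul_of_nonneg_right (le_abs_self (1 + τ)) (ht f).le) hθ.le
    have h3b : |1 + τ| * t f * θ ≤ |1 + τ| * (∑ f, t f + 1) * θ :=
      mul_le_mul_of_nonneg_right (mul_le_mul_of_nonneg_left (by linarith) (abs_nonneg _)) hθ.le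
    have h4 : |1 + τ| * (∑ f, t f + 1) * θ ≤ θ * ((|1 + τ| + 1) * (∑ f, t f + 1)) := by
      nlinarith [mul_nonneg (show (0 : ℝ) ≤ ∑ f, t f + 1 by linarith) hθ.le]
    linarith
  have e : lam f * t f ^ 2 * (θ ^ 1 * Real.exp (-(t f * θ))) +
      -((1 + τ) * lam f * t f ^ 3 / 2) * (θ ^ 2 * Real.exp (-(t f * θ))) =
      lam f * t f ^ 2 * θ * Real.exp (-(t f * θ)) * (1 - (1 + τ) * t f * θ / 2) := by ring
  rw [e]
  have : 0 < 1 - (1 + τ) * t f * θ / 2 := by linarith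
  have := hlam f; have := ht f
  positivity

/-- **TOY THEOREM, analytic-multiplicity form** (via the tree's PROVED Pólya–Szegő V.80,
`LaguerreRuleOfSigns.polyaSzego_V80_laplace_zeros_le_signReversals_holds`): for `r > 0`, `t_f > 0`, `λ_f > 0` and real `τ`, the
function `A_toy` has at most `2r − 1` zeros on `(0, ∞)` counted with multiplicity through iterated derivatives. -/
theorem toyA_zerosWithMultiplicityLE (hr : 0 < r) (ht : ∀ f, 0 < t f) (hlam : ∀ f, 0 < lam f) :
    LaguerreRuleOfSigns.ZerosWithMultiplicityLE (toyA t lam τ) (Set.Ioi 0) (2 * r - 1) := by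
  classical
  set g : ℝ → ℝ := fun θ => ∑ f, (lam f * t f ^ 2 * (θ ^ 1 * Real.exp (-(t f * θ))) +
    -((1 + τ) * lam f * t f ^ 3 / 2) * (θ ^ 2 * Real.exp (-(t f * θ)))) with hg
  -- reversals of sign of the density
  have hS : (Finset.univ.image (fun f : Fin r => -t f)).card ≤ r :=
    card_image_le.trans (by rw [Finset.card_univ, Fintype.card_fin])
  have hSR : LaguerreRuleOfSigns.SignReversalsLE g (Set.Ioi 0) (2 * r - 1) :=
    (signReversalsLE_of_signChangesLE (signChangesLE_toyDensity t lam τ)).mono_right (by omega)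
  -- the density is not a.e. zero on (0, ∞)
  set θ₁ : ℝ := 1 / ((|1 + τ| + 1) * (∑ f, t f + 1)) with hθ₁
  have hθ₁pos : 0 < θ₁ := by
    have := sum_nonneg (s := Finset.univ) fun f (_ : f ∈ Finset.univ) => (ht f).le
    rw [hθ₁]; positivity
  have hnae : ¬ (∀ᵐ θ ∂(volume.restrict (Set.Ioi (0 : ℝ))), g θ = 0) := by
    intro hae
    rw [ae_iff] at hae
    have hsub : Set.Ioo 0 θ₁ ⊆ {θ | ¬ g θ = 0} := fun θ hθ =>
      (toyDensity_pos t lam τ ht hlam hr hθ.1 (by rw [hθ₁] at hθ; exact hθ.2)).ne'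
    have h0 : (volume.restrict (Set.Ioi (0 : ℝ))) (Set.Ioo 0 θ₁) = 0 := measure_mono_null hsub hae
    rw [Measure.restrict_apply measurableSet_Ioo, Set.inter_eq_left.2 (Set.Ioo_subset_Ioi_self),
      Real.volume_Ioo] at h0
    have : ENNReal.ofReal (θ₁ - 0) ≠ 0 := (ENNReal.ofReal_pos.2 (by linarith)).ne'
    exact this h0
  -- absolute convergence at x₀ = 0
  have hint0 : IntegrableOn (fun θ => g θ * Real.exp (-(θ * 0))) (Set.Ioi 0) := by
    have hterm : ∀ f, IntegrableOn (fun θ : ℝ => lam f * t f ^ 2 * (θ ^ 1 * Real.exp (-(t f * θ))) +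
        -((1 + τ) * lam f * t f ^ 3 / 2) * (θ ^ 2 * Real.exp (-(t f * θ)))) (Set.Ioi 0) := fun f =>
      ((integrableOn_pow_mul_exp_neg_mul_Ioi (ht f) 1).const_mul _).add
        ((integrableOn_pow_mul_exp_neg_mul_Ioi (ht f) 2).const_mul _)
    have hsum : IntegrableOn g (Set.Ioi 0) := by
      have := integrable_finsetSum univ
        (f := fun f (θ : ℝ) => lam f * t f ^ 2 * (θ ^ 1 * Real.exp (-(t f * θ))) +
          -((1 + τ) * lam f * t f ^ 3 / 2) * (θ ^ 2 * Real.exp (-(t f * θ)))) (fun f _ => hterm f)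
      refine this.congr (Eventually.of_forall fun θ => ?_)
      simp [hg]
    refine hsum.congr (Eventually.of_forall fun θ => ?_)
    simp
  have hV := LaguerreRuleOfSigns.polyaSzego_V80_laplace_zeros_le_signReversals_holds g (2 * r - 1) 0 hSR hnae hint0
  -- the transform is A_toy on (0, ∞)
  refine hV.congr isOpen_Ioi (fun x hx => ?_) (subset_refl _)
  have hx' : (0 : ℝ) < x := hx
  rw [← integral_toyDensity t lam τ ht hx']
  refine integral_congr_ae (Eventually.of_forall fun θ => ?_)
  show g θ * Real.exp (-(θ * x)) = Real.exp (-(x * θ)) * g θ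
  rw [mul_comm x θ, mul_comm]

end ToyALaw

end Summit.ValiantsHypothesis.ValiantsHypothesis.Theorems.LacunarySymmetroidMatrixDescartes
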